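import Summits.NavierStokesRegularity.NavierStokesRegularity.Theorems.FrequencyRigidity.Negative.FrequencyStructure
import Summits.NavierStokesRegularity.NavierStokesRegularity.Theorems.AdaptedFrequencyFrequencyRigidityUnitTimeDerivBounds
import Summits.NavierStokesRegularity.NavierStokesRegularity.Theorems.AdaptedFrequencyFrequencyRigidityScaleInvariantBoundsOfUnitTime
import Summits.NavierStokesRegularity.NavierStokesRegularity.Theorems.AdaptedFrequencyFrequencyRigidityVorticitySqTransport
import Summits.NavierStokesRegularity.NavierStokesRegularity.Theorems.AdaptedFrequencyFrequencyRigidityKernelPairing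
import Summits.NavierStokesRegularity.NavierStokesRegularity.Theorems.AdaptedFrequencyFrequencyRigidityVorticitySqBounds
import Summits.NavierStokesRegularity.NavierStokesRegularity.Theorems.AdaptedFrequencyFrequencyRigidityFlatSelfSimilarLeaf
import Summits.NavierStokesRegularity.NavierStokesRegularity.Theorems.AdaptedFrequencyFrequencyRigidityFlatNoSteadySlice
import Summits.NavierStokesRegularity.NavierStokesRegularity.Theorems.AdaptedFrequencyFrequencyRigidityFlatReduction
import Summits.NavierStokesRegularity.NavierStokesRegularity.Theorems.AdaptedFrequencyFrequencyRigidityCriticalStrainFloor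
import Summits.NavierStokesRegularity.NavierStokesRegularity.Theorems.AdaptedFrequencyFrequencyRigidityStrictStrainFloor
import Summits.NavierStokesRegularity.NavierStokesRegularity.Theorems.AdaptedFrequencyFrequencyRigidityAncientDriftNormalForm
import Summits.NavierStokesRegularity.NavierStokesRegularity.Theorems.AdaptedFrequencyFrequencyRigidityGalileanOseenIdentity
import Summits.NavierStokesRegularity.NavierStokesRegularity.Theorems.AdaptedFrequencyFrequencyRigiditySmallConstantBootstrap
import Summits.NavierStokesRegularity.NavierStokesRegularity.Theorems.AdaptedFrequencyFrequencyRigidityOfLiouville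
import Summits.NavierStokesRegularity.NavierStokesRegularity.Theorems.AdaptedFrequencyFrequencyRigidityWallUnconditional
import Summits.NavierStokesRegularity.NavierStokesRegularity.Theorems.AdaptedFrequencyFrequencyRigidityFlatReductionLarge
import Summits.NavierStokesRegularity.NavierStokesRegularity.Theorems.AdaptedFrequencyFrequencyRigidityOfTypeIAncientLiouville
import Literature.Analysis.FluidPDE.AdaptedBackwardKernel
import Literature.Analysis.FluidPDE.SelfSimilar
import Literature.Analysis.FluidPDE.TaoEnstrophyLocalisation
import Literature.Analysis.FluidPDE.OseenDuhamelPairCalculus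
import Literature.Analysis.FluidPDE.ClassicalSolutionRescale
import HarnessLib.Audit

/-!
# Line `two-ended-pinning` — crux `FrequencyRigidity` (stmt-NavierStokesRegularity-2955), route `AdaptedFrequency`

CRUX-PLAN skeleton (planner `cruxplan-stmt-NavierStokesRegularity-2955-two-ended-pinning`, round 1; idea card
`Cruxes/FrequencyRigidity/Ideas/two-ended-pinning.md`, triage TRIAGE-r1-{1,2,3}: pass ×3).

SKELETON v7 (lead c5 `prover-line-stmt-NavierStokesRegularity-2955-c5-0`, continuation, 2026-08-16): composition, registered stub
set and the single open stub S3L are UNCHANGED from v6.2 (sha 44a1e4fa); NEW is only the SHARP upper arrow, landed p121984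
(`Theorems/…OfTypeIAncientLiouville.lean`, registered sub-goal `frequencyRigidity_of_typeIAncientLiouville`): the tree carries (L′)
as an ITEM — `Theses.ExtremalTypeIConstant.TypeIAncientLiouville` = stmt-NavierStokesRegularity-4050 (shared with route
SymmetryModuliCount; "every jointly smooth, divergence-free, KNSS-mild (Oseen gauge), time-Type-I ancient field vanishes"),
strictly weaker than (L) = stmt-10661, and (L′) ⇒ S3L ⇒ crux through the LANDED normal form S3a + S3b (gauge change: intrinsic
drift, co-moving zero-drift Oseen identity, constant re-anchoring, KNSS smoothing of the translates).  Re-exported in §"Closures" on the stub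
(`S3L_of_typeIAncientLiouville`; the crux-level bridge is deliberately not re-exported, see there).  So, checked end to end:
    (L) = stmt-10661 ⇒ (L′) = stmt-4050 (p122548) ⇒ FrequencyRigidity (p121984) ⇔ S3L (p118721) ⇒ ∀ α, RSSLiouvilleBounded α (p119711)
    [direct (L) ⇒ crux: p107437; (L′) is the weaker hypothesis],
and the crux closes the instant item 4050 does (one line over `frequencyRigidity_of_typeIAncientLiouville`).

SKELETON v6.2 (lead c3, cycle 1 close): v6.1 + §"Closures" at the end — the CONDITIONAL closure of the crux on the KNSS
Liouville conjecture (`FrequencyRigidity_of_liouvilleConjectureNS`, landed p107437: (L) ⇒ crux WITHOUT the frequency clause) and the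
UNCONDITIONAL wall (`wall_rssLiouvilleBounded`: crux ⇒ ∀α RSSLiouvilleBounded α, the refuter's RSSWall with its kernel hypothesis
DISCHARGED by the landed wall engine S4 `stub_kernelCompactness` p108781 + S5 `stub_coRotatingKernel` p118450 + `linearTypeIDriftKernel`).
So, checked end to end:  (L) ⇒ FrequencyRigidity ⇔ Stub 3 = [C/√ν < 1/(96C₀): PROVED] ∧ [S3L: open] ⇒ ∀α RSSLiouvilleBounded α.

SKELETON v6.1 (lead c3): S3a, S3b, S3c LANDED (p107013, p107082, p107150) and imported below; the ONLY `sorry` is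
again ONE stub, S3L `stub_flatEnstrophyLiouville_largeConstant` (the open core) — i.e. Stub 3 now holds UNCONDITIONALLY for
`C/√ν < 1/(96 C₀)`.

SKELETON v6 (lead c3 `prover-line-stmt-NavierStokesRegularity-2955-c3-0`, continuation, 2026-08-16).  Composition
`FrequencyRigidity_of` and the five LANDED analytic stubs are UNCHANGED; what changes is Stub 3, RESHAPED by the size
of the Type-I constant `C/√ν` (the only scale-free number of a flat inhabitant at the velocity level):
* the SMALL-constant half `C/√ν < 1/(96 C₀)` (`C₀ = oseenSliceConst ℝ³`, the tree's Oseen slice constant) is PROVABLE —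
  the Leray/KNSS gap run in the Galilean mild frame — and is registered as THREE worker-sized stubs:
  `stub_ancientDriftNormalForm` (S3a: KNSS Lemma 3.1 on the whole ancient interval — an intrinsic continuous parasitic
  drift `β`, normalised at `t → −∞`, with `‖β(t)‖ ≤ (8C + 32C₀C²)/√(−t)`), `stub_galileanOseenIdentity` (S3b: the
  zero-drift Oseen identity in the co-moving frame `y ↦ y + ∫β`, the tree's PROVED `IsKNSSDriftMild.GalileanCovariance`
  read on the ancient interval), `stub_smallConstantBootstrap` (S3c: the tree's bootstrap `smallConstantLiouville_*`
  re-run on `u − β` through that identity: `8C₀A < 1` forces `u(t,·) ≡ β(t)`); the glue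
  `flatEnstrophyLiouville_of_split` (viscosity normalisation + constants + `curl ≡ 0 ⇒ H(−1) = 0 ≠ A`) is proved here;
* the LARGE-constant half `stub_flatEnstrophyLiouville_largeConstant` (S3L: no flat inhabitant with
  `C/√ν ≥ 1/(96 C₀)`) is the open core, unchanged in difficulty (⊇ bounded-class RSS-Liouville, `Negative/RSSWall.lean`).
In parallel this seat makes the UPPER half of the sandwich a checked theorem (`Theorems/…OfLiouville.lean`, proposal in
flight): `LiouvilleConjectureNS → FrequencyRigidity` and `→ Sig.stub_flatEnstrophyLiouville`, via the bridge "a bounded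
classical ancient NS flow is a bounded ancient mild solution of the duality-form class" — (L) kills the crux WITHOUT the
frequency clause.  So in Lean: (L) ⇒ crux ⇔ Stub 3 ⇒ ∀α RSSLiouvilleBounded α (mod H_α), and Stub 3 = S3-small ∧ S3L.

SKELETON v5 (lead c2 `prover-line-stmt-NavierStokesRegularity-2955-c2-0`, continuation, 2026-08-16): byte-identical to
v4 below except that the STRICT strain-floor leaf (p98197, now built on the farm) is imported and re-exported
(`leaf_strictStrainFloor`); composition, registered stub set and the single open stub are UNCHANGED.

SKELETON v4 (lead c1 `prover-line-stmt-NavierStokesRegularity-2955-c1-0`, continuation, 2026-08-16): composition and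
the single open stub UNCHANGED from lead-0's v3 (Stub 3 `stub_flatEnstrophyLiouville` = the crux in pinned normal form,
`stub_flatReduction` p91321); NEW in v4 is only the record of the LANDED NECESSARY CONDITIONS on a flat inhabitant that use
the Navier–Stokes dynamics (registered sub-goals of Stub 3, all ACCEPTED, re-exported in §"Landed leaves" below):
self-similar leaf p87055, no-steady-slice p88400 (lead-0); critical-strain floor p97154 and STRICT floor p98197 (lead c1:
at every `t < 0` a flat inhabitant stretches its vorticity at a rate `> 1/(−t)` somewhere, `∫|∇ω|²K > 0`, `C'₁ > 1`,
no planar / stretching-free inhabitant).  A second lead (`…-2955-1`, line `moving-adjoint-bernoulli`) concurrently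
builds the wall ENGINE (ancient kernel compactness + co-rotating kernel ⇒ the RSS wall `Negative/RSSWall.lean`
unconditionally).  PRICING CORRECTION recorded by lead c1: `pineauVicol2026_rss_liouville` (PV 2026 Thm 1.4) assumes the
SPATIAL Type-I bound `C₀/(‖x‖+√(−t))` (profile decay), so in the bounded-profile class this stub quantifies over,
RSS-Liouville is known for `α = 0` only (Tsai `q = ∞`) and OPEN FOR EVERY `α ≠ 0`, not merely on the window `α ≈ 1`.

The crux `FrequencyRigidity = ¬ ∃ (ν C Λ₀ v q K), …` forbids a smooth ancient Navier–Stokes flow on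
`ℝ³ × (−∞,0)` with the GLOBAL Type-I bound `‖v(t)‖∞ ≤ C/√(−t)`, an adapted two-sided Gaussian-comparable
kernel `K` at `(0,0)`, positive adapted enstrophy `H(t) = ∫ ‖curl v(t)‖² K(t)` and CONSTANT adapted frequency
`Λ(t) = (−t)H′/H ≡ Λ₀`.

THE LEVER (idea card; already a CHECKED theorem of the standing disprover, landed as
`Theorems/FrequencyRigidity/Negative/FrequencyStructure.lean`: `FreqClause.power_law`,
`FreqClause.exponent_eq_two` — imported here, not re-proved): constant `Λ` integrates to the exact power law
`H(t) = H(−1)(−t)^{−Λ₀}`, and the two-ended Type-I ENSTROPHY bound `H(t) ≤ M(−t)^{−2}` (both ends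
`t ↑ 0` and `t → −∞`) PINS the exponent: `Λ₀ = 2`, i.e. `t² H(t) ≡ A > 0` — the witness reproduces the
backward-self-similar enstrophy law on the nose.  What the lever needs and the crux does not literally
supply are its two inputs, which are the first two stubs (shared by every line on this crux, triage G1/G6):

* `stub_scaleInvariantBounds` (M–L): classical + GLOBAL time-Type-I on `(−∞,0)` ⇒ the scale-invariant KNSS
  derivative bounds `‖Dᵏv(t)‖∞ ≤ C'_k (−t)^{−(k+1)/2}`, `k ≥ 1`, constants depending on `(ν, C, k)` only
  (KNSS 2009 §4 on windows + parabolic/viscosity rescaling; derivatives of order `≥ 1` are blind to the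
  Galilei wobble `U(x − B(t), t) + B′(t)`).  Gives the enstrophy bound with `M = (‖curlCLM‖ C'_1)²` (proved
  below, `adaptedEnstrophy_le_of_bounds`, unit mass of `K`).
* `stub_enstrophyFirstVariation` (L): the KERNEL CALCULUS — `H ∈ C¹(−∞,0)` with the transport-free first
  variation `H′(t) = 2 ∫ (⟪ω, Dv ω⟫ − ν |∇ω|²_F) K` (cut-off, adjoint equation of `K`, `div v = 0`, vorticity
  equation; only the Gaussian UPPER bound of `K` is used).  Its differentiability half is the `hd` of
  `FreqClause.exponent_eq_two` (load-bearing: at `Λ₀ = 0` Mathlib's junk `deriv` would otherwise bite).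
* `stub_flatEnstrophyLiouville` (XL, HARDEST — the card's Transfer `C⁺` in normal form): there is NO
  "flat inhabitant": a classical ancient flow with the global Type-I bound, the scale-invariant bounds, an
  adapted comparable kernel, and `H(t) = A(−t)^{−2}` EXACTLY with `A > 0` (plus, for self-containedness, the
  first-variation clause).  `C⁺` is invariant under the full parabolic scaling group about `(0,0)` and closed
  under local smooth limits with the SAME constants (blow-down/blow-up tangent flows keep `A`), which the
  `Λ ≡ Λ₀` form is not before pinning.  Honest residual (card §(3), triage S1/G2): steady-in-similarity
  inhabitants are dead (Tsai `q = ∞`, in tree `tsai_selfsimilar_bounded_holds`); bounded-profile backward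
  ROTATED self-similar flows (Perelman/RSS) with their co-rotating invariant density ARE flat inhabitants
  identically, so this stub contains RSS-Liouville for every `α` in the bounded class — dead for `|α| ≪ 1`,
  `|α| ≫ 1` in the decaying class (Pineau–Vicol 2026 Thm 1.4, `pineauVicol2026_rss_liouville`), OPEN on the
  window `α ≈ 1` (their Conj. 1.1 = Bradshaw–Tsai 2017 OP 5.2).  The crux is PV-window-hard and so is this stub.

COMPOSITION `FrequencyRigidity_of` (real proof): unbundle the crux (`Negative.frequencyRigidity_iff`) →
stub 1 → stub 2 (`hd`) → `adaptedEnstrophy_le_of_bounds` (`hM`) → `FreqClause.exponent_eq_two` (`Λ₀ = 2`) →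
`FreqClause.power_law` (flat law, `A = H(−1) > 0` by the positivity clause) → stub 3.

DISPROOF USED (`Cruxes/FrequencyRigidity/Disproof.lean`, cdisprove v3, NO KILL; landed twins under
`Theorems/FrequencyRigidity/Negative/`): (A) `frequencyRigidity_false_without_posH` — positivity is used in
the composition (`A = H(−1) > 0`) and is clause (vii) of `IsFlatInhabitant`; (B)
`frequencyRigidity_false_without_typeI` / `_false_with_local_typeI` (rigid rotation, `Λ ≡ 0`) — the GLOBAL
bound is used twice: by `stub_scaleInvariantBounds` (whole-space KNSS windows; rigid rotation has `‖Dv‖ ≡ 1`,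
not `O((−t)^{−1})` as `t → −∞`) and at the ancient end of the pinning (`Λ₀ ≥ 2`); (C)
`frequencyRigidity_false_without_momentum` (kinematic self-similar swirl, `Λ ≡ 2`, `H = A/t²`) — confronted,
not dodged: the swirl satisfies every clause of `IsFlatInhabitant` except the momentum equation, so
`stub_flatEnstrophyLiouville` must use the Navier–Stokes dynamics (as its docstring says); (T) is imported.
`ledger negatives --problem NavierStokesRegularity` (2 entries: stmt-4055, stmt-0154) — unrelated; no stub
restates either.
-/

noncomputable section

set_option linter.dupNamespace false

namespace Summit.NavierStokesRegularity.NavierStokesRegularity.Cruxes.FrequencyRigidity.TwoEndedPinning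

open Literature.Analysis.FluidPDE MeasureTheory Set Filter Topology Function
open scoped RealInnerProductSpace Laplacian ContDiff

/-- Physical space `ℝ³`. -/
abbrev E3 := EuclideanSpace ℝ (Fin 3)

/-! ## Vocabulary of the line -/

/-- **Scale-invariant (KNSS) derivative bounds** of an ancient field on `(−∞,0)`:
`‖Dᵏ v(t, x)‖ ≤ C'_k · (−t)^{−(k+1)/2}` for every order `k ≥ 1`, every `t < 0` and every `x`
(the Type-I bound itself is the case `k = 0`, kept separately as `HasTypeITimeDecay`). -/
def ScaleInvariantBounds (C' : ℕ → ℝ) (v : ℝ → E3 → E3) : Prop :=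
  ∀ k : ℕ, 1 ≤ k → ∀ t < 0, ∀ x, ‖iteratedFDeriv ℝ k (v t) x‖ ≤ C' k * (-t) ^ (-((k : ℝ) + 1) / 2)

/-- **The transport-free first-variation density** of the adapted enstrophy:
`2 (⟪ω, Dv ω⟫ − ν |∇ω|²_F)` with `ω = curl v(t)`, `Dv ω = (ω·∇)v` the stretching term and
`|∇ω|²_F = ∑ᵢ ‖∂ᵢ ω‖²` the Frobenius norm (`frobeniusNormSq`).  (`⟪ω, Dv ω⟫ = ⟪ω, S ω⟫`, `S` the strain.) -/
def firstVariationDensity (ν : ℝ) (v : ℝ → E3 → E3) (t : ℝ) (x : E3) : ℝ :=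
  2 * (⟪curl (v t) x, fderiv ℝ (v t) x (curl (v t) x)⟫ - ν * frobeniusNormSq (fderiv ℝ (curl (v t)) x))

/-- **A FLAT INHABITANT** — the pinned normal form of a witness against the crux (the card's `C⁺`):
(i) `0 < ν`; (ii) `(v, q)` classical Navier–Stokes on `ℝ³ × (−∞,0)`; (iii) the GLOBAL time-Type-I bound
`‖v(t,x)‖ ≤ C/√(−t)`; (iv) the scale-invariant derivative bounds (output of `stub_scaleInvariantBounds`);
(v) `K` an adapted backward kernel of `∂ₜ + v·∇ − νΔ` on `(−∞,0)` with pole `(0,0)` (the crux's five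
clauses, `isAdaptedBackwardKernel_iff`); (vi) two-sided Gaussian comparability
(`isGaussianComparable_iff_fin_three`); (vii) `0 < A`; (viii) the EXACT self-similar enstrophy law
`H(t) = A (−t)^{−2}` for all `t < 0` (pinning); (ix) `H ∈ C¹` with the transport-free first variation
(output of `stub_enstrophyFirstVariation`; with (viii) it gives the instantaneous law
`∫ (⟪ω, Dv ω⟫ − ν|∇ω|²_F) K = A (−t)^{−3}` at EVERY `t < 0`).  Clauses (iv), (ix) are consequences of
the others; they are carried so that the Liouville stub is self-contained. -/
def IsFlatInhabitant (ν C A : ℝ) (C' : ℕ → ℝ) (v : ℝ → E3 → E3) (q : ℝ → E3 → ℝ)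
    (K : ℝ → E3 → ℝ) : Prop :=
  0 < ν ∧ IsClassicalNSSolutionOn (Iio 0) ν 0 v q ∧ HasTypeITimeDecay C v ∧
    ScaleInvariantBounds C' v ∧ IsAdaptedBackwardKernel ν v (Iio 0) 0 0 K ∧
    IsGaussianComparable K (Iio 0) 0 0 ∧ 0 < A ∧
    (∀ t < 0, adaptedEnstrophy v K t = A * (-t) ^ (-(2 : ℝ))) ∧
    (∀ t < 0, HasDerivAt (adaptedEnstrophy v K) (∫ x, firstVariationDensity ν v t x * K t x) t)

/-! ## The stubs (v2 — lead's reshape, 2026-08-16)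

Each stub's statement is the `Prop` `Sig.stub_<name>` (its SIGNATURE, written over TREE declarations only,
fully qualified, so that a worker's landed `Theorems/` file can state it verbatim) and the registered
obligation is `theorem stub_<name> : Sig.stub_<name> := by sorry`.  The lead's reshape splits the planner's
two provable stubs into worker-sized pieces without touching the composition idea:

* planner's `stub_scaleInvariantBounds`  =  `stub_unitTimeDerivBounds` (KNSS window bound at the unit time
  `t = −1`, all orders, constants uniform in the Type-I class)  +  `stub_scaleInvariantBounds_of_unitTime`
  (viscosity + parabolic rescaling transfer to every `t < 0`; pure bookkeeping);
* planner's `stub_enstrophyFirstVariation`  =  `stub_vorticitySqTransport` (pointwise transport identity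
  `(∂ₜ + v·∇ − νΔ)‖ω‖² = 2⟪ω, Dv ω⟫ − 2ν|∇ω|²_F`, the vorticity equation of the tree)  +  `stub_kernelPairing`
  (generic kernel calculus `d/dt ∫ φK = ∫ (∂ₜφ + v·∇φ − νΔφ)K` for a jointly smooth `φ` with locally uniform
  bounds, against an adapted Gaussian-comparable kernel — cut-off, adjoint clause, IBP, `R → ∞`)  +
  `stub_vorticitySqBounds` (`φ = ‖curl v‖²` is jointly smooth and has those bounds under the scale-invariant
  bounds);
* `stub_flatEnstrophyLiouville` unchanged (held by the lead).

The planner's two signatures survive below as DERIVED `Prop`s (`Sig.stub_scaleInvariantBounds`,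
`Sig.stub_enstrophyFirstVariation`) with in-file proofs from the new stubs (`scaleInvariantBounds_of`,
`enstrophyFirstVariation_of`), and `FrequencyRigidity_of` consumes the six registered stubs BY NAME. -/

/-- Planner's Stub 1 (now DERIVED from `stub_unitTimeDerivBounds` + `stub_scaleInvariantBounds_of_unitTime`):
scale-invariant derivative bounds, constants uniform in the Type-I class. [cite: KochNadirashviliSereginSverak2009, §4] -/
def Sig.stub_scaleInvariantBounds : Prop :=
  ∀ ν C : ℝ, 0 < ν → ∃ C' : ℕ → ℝ,
    ∀ (v : ℝ → E3 → E3) (q : ℝ → E3 → ℝ),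
      IsClassicalNSSolutionOn (Iio 0) ν 0 v q → HasTypeITimeDecay C v → ScaleInvariantBounds C' v

/-- Planner's Stub 2 (now DERIVED from `stub_vorticitySqTransport` + `stub_kernelPairing` +
`stub_vorticitySqBounds`): the transport-free first variation of the adapted enstrophy. [cite: Poon1996, §2] -/
def Sig.stub_enstrophyFirstVariation : Prop :=
  ∀ (ν C : ℝ) (C' : ℕ → ℝ) (v : ℝ → E3 → E3) (q : ℝ → E3 → ℝ) (K : ℝ → E3 → ℝ), 0 < ν →
    IsClassicalNSSolutionOn (Iio 0) ν 0 v q → HasTypeITimeDecay C v → ScaleInvariantBounds C' v →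
    IsAdaptedBackwardKernel ν v (Iio 0) 0 0 K → IsGaussianComparable K (Iio 0) 0 0 →
    ∀ t < 0, HasDerivAt (adaptedEnstrophy v K) (∫ x, firstVariationDensity ν v t x * K t x) t

/-- **Stub 1a — KNSS window bound at the unit time (size M–L).**  For every Type-I constant `C` there
are constants `C'_k` such that every classical Navier–Stokes flow `(u, p)` with viscosity `1` on
`ℝ³ × (−∞,0)` with the GLOBAL time-Type-I bound `‖u(t,x)‖ ≤ C/√(−t)` obeys `‖Dᵏu(−1, x)‖ ≤ C'_k` for all
`k ≥ 1` and all `x`.  Why true / how: on the window `t ∈ (−3, −⅛)` the flow is bounded by `3C`, hence a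
bounded weak solution there (`IsClassicalNSSolutionOn.isBoundedWeakNSSolutionOn`, time-translated by
`comp_add_right` as in `ChaeWolfRemovingDSSBounds.exists_uniform_lipschitz`); the PROVED tree theorem
`KNSS2009_regularity_boundedWeak_window_holds` gives `u = U + b(t)` a.e. with `‖DᵏU‖ ≤ C(k, δ)` on
`(δ, T)`; derivatives of order `≥ 1` do not see `b`, so `Dᵏu(τ,·) = DᵏU(τ,·)` at a.e. `τ` (slices are
continuous: `Continuous.ae_eq_iff_eq`), and the a.e.-in-`τ` bound upgrades to EVERY `τ` (in particular
`τ ↦ −1`) by continuity of `τ ↦ Dᵏu(τ, x)` (`IsSmoothSpaceTimeOn.hasDerivAt_iteratedFDeriv_slice`) and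
`ChaeWolf.le_of_ae_le_of_continuousOn`.  Uses the GLOBAL bound (Disproof (B): rigid rotation is not
bounded). [cite: KochNadirashviliSereginSverak2009, §4 (4.10) and proof of Thm 5.2 first sentence] -/
def Sig.stub_unitTimeDerivBounds : Prop :=
  ∀ C : ℝ, ∃ C' : ℕ → ℝ,
    ∀ (u : ℝ → EuclideanSpace ℝ (Fin 3) → EuclideanSpace ℝ (Fin 3))
      (p : ℝ → EuclideanSpace ℝ (Fin 3) → ℝ),
      Literature.Analysis.FluidPDE.IsClassicalNSSolutionOn (Set.Iio 0) 1 0 u p →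
      Literature.Analysis.FluidPDE.HasTypeITimeDecay C u →
      ∀ k : ℕ, 1 ≤ k → ∀ x : EuclideanSpace ℝ (Fin 3), ‖iteratedFDeriv ℝ k (u (-1)) x‖ ≤ C' k

/-- **Stub 1b — rescaling transfer (size M, pure bookkeeping).**  The unit-time bound of Stub 1a (for
EVERY Type-I constant) implies the scale-invariant bounds `‖Dᵏv(t,x)‖ ≤ C'_k (−t)^{−(k+1)/2}` for every
classical flow with ANY viscosity `ν > 0` and the time-Type-I bound, with constants depending on
`(ν, C, k)` only.  How: viscosity rescaling `u(s,x) = ν⁻¹ v(ν⁻¹ s, x)` is classical with viscosity `1` on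
`(−∞,0)` (`IsClassicalNSSolutionOn.viscosityRescale_set` with `S = S' = Iio 0`, `timeRescale`) and
Type-I with constant `C/√ν`; for `s₀ < 0` the parabolic rescaling `nsRescale λ u`, `λ = √(−s₀)`
(`IsClassicalNSSolutionOn.nsRescale_holds`, preimage of `Iio 0` is `Iio 0`; `HasTypeITimeDecay.nsRescale`,
SAME constant) has `(nsRescale λ u)(−1, y) = λ u(s₀, λ y)`, so
`Dᵏ(nsRescale λ u (−1))(y) = λ^{k+1} (Dᵏu(s₀))(λ y)` (chain rule for a homothety, e.g.
`ContinuousLinearMap.iteratedFDeriv_comp_right` / `iteratedFDeriv_comp_smul`-type lemmas, cf. the tree's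
`norm_iteratedFDeriv_comp_smul_le`, `TaoQuantitativeReduction.norm_iteratedFDeriv_nsRescaleData_le`), whence
`‖Dᵏu(s₀, x)‖ ≤ C'_k (−s₀)^{−(k+1)/2}` and `Dᵏv(t) = ν Dᵏu(νt)`. [cite: KochNadirashviliSereginSverak2009, §1 (scaling) and §4] -/
def Sig.stub_scaleInvariantBounds_of_unitTime : Prop :=
  (∀ C : ℝ, ∃ C' : ℕ → ℝ,
    ∀ (u : ℝ → EuclideanSpace ℝ (Fin 3) → EuclideanSpace ℝ (Fin 3))
      (p : ℝ → EuclideanSpace ℝ (Fin 3) → ℝ),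
      Literature.Analysis.FluidPDE.IsClassicalNSSolutionOn (Set.Iio 0) 1 0 u p →
      Literature.Analysis.FluidPDE.HasTypeITimeDecay C u →
      ∀ k : ℕ, 1 ≤ k → ∀ x : EuclideanSpace ℝ (Fin 3), ‖iteratedFDeriv ℝ k (u (-1)) x‖ ≤ C' k) →
  ∀ ν C : ℝ, 0 < ν → ∃ C' : ℕ → ℝ,
    ∀ (v : ℝ → EuclideanSpace ℝ (Fin 3) → EuclideanSpace ℝ (Fin 3))
      (q : ℝ → EuclideanSpace ℝ (Fin 3) → ℝ),
      Literature.Analysis.FluidPDE.IsClassicalNSSolutionOn (Set.Iio 0) ν 0 v q →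
      Literature.Analysis.FluidPDE.HasTypeITimeDecay C v →
      ∀ k : ℕ, 1 ≤ k → ∀ t : ℝ, t < 0 → ∀ x : EuclideanSpace ℝ (Fin 3),
        ‖iteratedFDeriv ℝ k (v t) x‖ ≤ C' k * (-t) ^ (-((k : ℝ) + 1) / 2)

/-- **Stub 2a — transport identity for `‖ω‖²` (size M).**  For a classical Navier–Stokes flow `(v, q)`
(any viscosity `ν`, zero force) on `ℝ³ × (−∞,0)` and `ω = curl v`, pointwise at every `t < 0`, `x`:
`∂ₜ‖ω‖² + D(‖ω‖²)·v − νΔ‖ω‖² = 2(⟪ω, Dv ω⟫ − ν|Dω|²_F)`.  How: `∂ₜ‖ω‖² = 2⟪ω, ∂ₜω⟫` with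
`∂ₜω = curl ∂ₜv` (`IsSmoothSpaceTimeOn.timeDerivWithin_vorticity_eq` / `hasDerivAt_fderiv_slice_clm`; on the
open set `Iio 0` the within-derivative is `deriv`, `IsSmoothSpaceTimeOn.timeDerivWithin_eq`), the tree's
vorticity equation `IsClassicalNSSolutionOn.curl_timeDerivWithin_eq`
(`curl ∂ₜv = νΔω − (v·∇)ω + (ω·∇)v`, `convect`), `D‖ω‖²·v = 2⟪ω, Dω v⟫` (`fderiv` of `‖·‖²`), and
`Δ‖ω‖² = 2⟪Δω, ω⟫ + 2|Dω|²_F` (`laplacian_inner_self_eq`, `real_inner_self_eq_norm_sq`). [cite: MajdaBertozziCUP2002, §1.1 (1.33); Tao2011, (10.18)] -/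
def Sig.stub_vorticitySqTransport : Prop :=
  ∀ (ν : ℝ) (v : ℝ → EuclideanSpace ℝ (Fin 3) → EuclideanSpace ℝ (Fin 3))
    (q : ℝ → EuclideanSpace ℝ (Fin 3) → ℝ),
    Literature.Analysis.FluidPDE.IsClassicalNSSolutionOn (Set.Iio 0) ν 0 v q →
    ∀ t : ℝ, t < 0 → ∀ x : EuclideanSpace ℝ (Fin 3),
      deriv (fun s => ‖Literature.Analysis.FluidPDE.curl (v s) x‖ ^ 2) t
          + fderiv ℝ (fun y => ‖Literature.Analysis.FluidPDE.curl (v t) y‖ ^ 2) x (v t x)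
          - ν * Laplacian.laplacian (fun y => ‖Literature.Analysis.FluidPDE.curl (v t) y‖ ^ 2) x =
        2 * (inner ℝ (Literature.Analysis.FluidPDE.curl (v t) x)
                (fderiv ℝ (v t) x (Literature.Analysis.FluidPDE.curl (v t) x))
              - ν * Literature.Analysis.FluidPDE.frobeniusNormSq
                (fderiv ℝ (Literature.Analysis.FluidPDE.curl (v t)) x))

/-- **Stub 2b — kernel pairing (size L; the analytic heart of the planner's Stub 2, pure kernel
calculus, no Navier–Stokes).**  Let `v` be jointly smooth on `(−∞,0) × ℝ³`, divergence free, with the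
time-Type-I bound; `K` an adapted backward kernel of `∂ₜ + v·∇ − νΔ` on `(−∞,0)` at `(0,0)`
(`C²`, `> 0`, `∂ₜK + DK·v + νΔK = 0`, unit mass, concentration) which is two-sided Gaussian-comparable;
`φ` a jointly smooth scalar field whose value, gradient, Laplacian and time derivative are bounded on
every compact time interval `[a,b] ⊂ (−∞,0)`, uniformly in `x`.  Then `t ↦ ∫ φ(t)K(t)` is differentiable
at every `t < 0` with derivative `∫ (∂ₜφ + Dφ·v − νΔφ) K` — transport drops out exactly.  How: for a
smooth cut-off `χ_R(x) = χ(‖x‖²/R²)` differentiate `∫ φχ_R K` under the integral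
(`hasDerivAt_integral_of_dominated_loc_of_deriv_le`, compact `x`-support, `∂ₜK` continuous), substitute the
adjoint clause `∂ₜK = −DK·v − νΔK`, integrate by parts on compact support (`div v = 0`; Green's second
identity for the Laplacian — tree `WholeSpaceIBP` / Mathlib `integral_mul_deriv_eq_deriv_mul`-type lemmas)
to get `d/dt ∫ φχ_R K = ∫ (∂ₜ(φχ_R) + D(φχ_R)·v − νΔ(φχ_R)) K`; then `R → ∞`: `∫ φχ_R K → ∫ φK` pointwise and
the derivatives converge LOCALLY UNIFORMLY in `t` (errors `≲ B ∫ (1 − χ_R)K + (B(1 + C/√(−b)) / R) ∫ K`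
with the Gaussian UPPER bound `K ≤ C₁(−b)^{−3/2} e^{−‖x‖²/(C₂(−a))}` on `[a,b]`), and
`hasDerivAt_of_tendstoLocallyUniformlyOn` concludes. [cite: Friedman1964, Ch. 1 §8 (adjoint operator); ConstantinIyer2007, §2] -/
def Sig.stub_kernelPairing : Prop :=
  ∀ (ν C : ℝ) (v : ℝ → EuclideanSpace ℝ (Fin 3) → EuclideanSpace ℝ (Fin 3))
    (K φ : ℝ → EuclideanSpace ℝ (Fin 3) → ℝ),
    Literature.Analysis.FluidPDE.IsSmoothSpaceTimeOn (Set.Iio 0) v →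
    (∀ t ∈ Set.Iio (0 : ℝ), Literature.Analysis.FluidPDE.VectorCalculus.IsDivFree (v t)) →
    Literature.Analysis.FluidPDE.HasTypeITimeDecay C v →
    Literature.Analysis.FluidPDE.IsAdaptedBackwardKernel ν v (Set.Iio 0) 0 0 K →
    Literature.Analysis.FluidPDE.IsGaussianComparable K (Set.Iio 0) 0 0 →
    Literature.Analysis.FluidPDE.IsSmoothSpaceTimeOn (Set.Iio 0) φ →
    (∀ a b : ℝ, a < b → b < 0 → ∃ B : ℝ, ∀ t ∈ Set.Icc a b, ∀ x : EuclideanSpace ℝ (Fin 3),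
        |φ t x| ≤ B ∧ ‖fderiv ℝ (φ t) x‖ ≤ B ∧ |Laplacian.laplacian (φ t) x| ≤ B ∧
          |deriv (fun s => φ s x) t| ≤ B) →
    ∀ t : ℝ, t < 0 →
      HasDerivAt (fun s => ∫ x, φ s x * K s x)
        (∫ x, (deriv (fun s => φ s x) t + fderiv ℝ (φ t) x (v t x)
                - ν * Laplacian.laplacian (φ t) x) * K t x) t

/-- **Stub 2c — bounds for `‖ω‖²` (size M).**  Under the classical hypotheses, the time-Type-I bound and
the scale-invariant derivative bounds of all orders `k ≥ 1`, the scalar field `φ(t,x) = ‖curl v(t,x)‖²` is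
jointly smooth on `(−∞,0) × ℝ³` and `φ`, `Dφ`, `Δφ`, `∂ₜφ` are bounded on every `[a,b] ⊂ (−∞,0)` uniformly
in `x` (the hypotheses of Stub 2b for this `φ`).  How: joint smoothness from `IsSmoothSpaceTimeOn` of `v`
(`fderiv_slice_apply`/`clm_comp` with `curlCLM`, `curl_eq_curlCLM`; `‖·‖²` smooth); `‖ω‖ ≤ ‖curlCLM‖‖Dv‖`
(`norm_curl_le`), `‖Dω‖ ≤ ‖curlCLM‖‖D²v‖`, `‖Δω‖ ≤ 3‖D²ω‖ ≲ ‖D³v‖` give `|φ| ≲ (−t)^{−2}`,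
`‖Dφ‖ ≤ 2‖ω‖‖Dω‖`, `|Δφ| ≤ 2‖ω‖‖Δω‖ + 2|Dω|²_F` (`laplacian_inner_self_eq`, `frobeniusNormSq ≤ 3‖·‖²`);
`∂ₜφ = 2⟪ω, ∂ₜω⟫` with `∂ₜω = curl ∂ₜv = νΔω − (v·∇)ω + (ω·∇)v`
(`IsClassicalNSSolutionOn.curl_timeDerivWithin_eq`, `‖v‖ ≤ C/√(−t)`); on `[a,b]` every power of `(−t)` is
bounded. [cite: KochNadirashviliSereginSverak2009, §4 (4.10)] -/
def Sig.stub_vorticitySqBounds : Prop :=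
  ∀ (ν C : ℝ) (C' : ℕ → ℝ) (v : ℝ → EuclideanSpace ℝ (Fin 3) → EuclideanSpace ℝ (Fin 3))
    (q : ℝ → EuclideanSpace ℝ (Fin 3) → ℝ),
    Literature.Analysis.FluidPDE.IsClassicalNSSolutionOn (Set.Iio 0) ν 0 v q →
    Literature.Analysis.FluidPDE.HasTypeITimeDecay C v →
    (∀ k : ℕ, 1 ≤ k → ∀ t : ℝ, t < 0 → ∀ x : EuclideanSpace ℝ (Fin 3),
        ‖iteratedFDeriv ℝ k (v t) x‖ ≤ C' k * (-t) ^ (-((k : ℝ) + 1) / 2)) →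
    Literature.Analysis.FluidPDE.IsSmoothSpaceTimeOn (Set.Iio 0)
        (fun t x => ‖Literature.Analysis.FluidPDE.curl (v t) x‖ ^ 2) ∧
      ∀ a b : ℝ, a < b → b < 0 → ∃ B : ℝ, ∀ t ∈ Set.Icc a b, ∀ x : EuclideanSpace ℝ (Fin 3),
        |‖Literature.Analysis.FluidPDE.curl (v t) x‖ ^ 2| ≤ B ∧
          ‖fderiv ℝ (fun y => ‖Literature.Analysis.FluidPDE.curl (v t) y‖ ^ 2) x‖ ≤ B ∧
          |Laplacian.laplacian (fun y => ‖Literature.Analysis.FluidPDE.curl (v t) y‖ ^ 2) x| ≤ B ∧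
          |deriv (fun s => ‖Literature.Analysis.FluidPDE.curl (v s) x‖ ^ 2) t| ≤ B

/-- **Stub 3 — FLAT-ENSTROPHY LIOUVILLE (the card's Transfer `C⁺`; size XL; the HARDEST stub and the
line's bet; held by the lead).**  There is no flat inhabitant (`IsFlatInhabitant`): no classical ancient Navier–Stokes flow on
`ℝ³ × (−∞,0)` with the global Type-I bound and an adapted comparable kernel at `(0,0)` whose adapted
enstrophy is EXACTLY `A(−t)^{−2}`, `A > 0`.  WHY EASIER than the crux as typed: one algebraic
normalisation instead of an ODE clause with `deriv` junk; invariant under the parabolic scaling group about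
`(0,0)` and closed under local smooth limits with the SAME constants `(ν, C, C', c₁, c₂, C₁, C₂, A)`, so
blow-down (`t → −∞`) and blow-up (`t ↑ 0`) tangent flows, minimal subsets of the translation hull in
`s = −log(−t)` and symmetry reductions are admissible moves; and the instantaneous law
`𝒮(t) − ν𝒫(t) = A(−t)^{−3}` (from (viii)–(ix)) holds at EVERY time.  WHY IT MIGHT FAIL: a bounded backward
ROTATED self-similar profile (`v = pvAnsatz α U₀`, Perelman/RSS) with `α` in Pineau–Vicol's open window
`[α_(C), ᾱ(C)]` and its co-rotating invariant-density kernel is a flat inhabitant (pattern rotation leaves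
`t²H` invariant) — Bradshaw–Tsai 2017 OP 5.2 = Pineau–Vicol 2026 Conj. 1.1; known kills: steady profiles
(`tsai_selfsimilar_bounded_holds`, in tree), `|α| ≪ 1` / `|α| ≫ 1` in the decaying class
(`pineauVicol2026_rss_liouville`, named fact), axisymmetric inhabitants (KNSS Thm 5.3), `C < ε₀√ν`
(Duhamel gap).  Must use the momentum equation (Disproof (C): the kinematic swirl meets every other clause). [cite: BradshawTsai2017CPDE, §5 OP 5.2; PineauVicol2026, Thm 1.4 and Conj. 1.1] -/
def Sig.stub_flatEnstrophyLiouville : Prop :=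
  ∀ (ν C A : ℝ) (C' : ℕ → ℝ) (v : ℝ → EuclideanSpace ℝ (Fin 3) → EuclideanSpace ℝ (Fin 3))
    (q : ℝ → EuclideanSpace ℝ (Fin 3) → ℝ) (K : ℝ → EuclideanSpace ℝ (Fin 3) → ℝ),
    ¬ (0 < ν ∧ Literature.Analysis.FluidPDE.IsClassicalNSSolutionOn (Set.Iio 0) ν 0 v q ∧
        Literature.Analysis.FluidPDE.HasTypeITimeDecay C v ∧
        (∀ k : ℕ, 1 ≤ k → ∀ t : ℝ, t < 0 → ∀ x : EuclideanSpace ℝ (Fin 3),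
          ‖iteratedFDeriv ℝ k (v t) x‖ ≤ C' k * (-t) ^ (-((k : ℝ) + 1) / 2)) ∧
        Literature.Analysis.FluidPDE.IsAdaptedBackwardKernel ν v (Set.Iio 0) 0 0 K ∧
        Literature.Analysis.FluidPDE.IsGaussianComparable K (Set.Iio 0) 0 0 ∧ 0 < A ∧
        (∀ t : ℝ, t < 0 →
          Literature.Analysis.FluidPDE.adaptedEnstrophy v K t = A * (-t) ^ (-(2 : ℝ))) ∧
        (∀ t : ℝ, t < 0 →
          HasDerivAt (Literature.Analysis.FluidPDE.adaptedEnstrophy v K)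
            (∫ x, (2 * (inner ℝ (Literature.Analysis.FluidPDE.curl (v t) x)
                          (fderiv ℝ (v t) x (Literature.Analysis.FluidPDE.curl (v t) x))
                        - ν * Literature.Analysis.FluidPDE.frobeniusNormSq
                          (fderiv ℝ (Literature.Analysis.FluidPDE.curl (v t)) x))) * K t x) t))

/-- The flat-inhabitant predicate IS the conjunction negated in `Sig.stub_flatEnstrophyLiouville`
(definitional unfolding of `ScaleInvariantBounds` and `firstVariationDensity`). -/
theorem isFlatInhabitant_iff (ν C A : ℝ) (C' : ℕ → ℝ) (v : ℝ → E3 → E3) (q : ℝ → E3 → ℝ)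
    (K : ℝ → E3 → ℝ) :
    IsFlatInhabitant ν C A C' v q K ↔
      (0 < ν ∧ IsClassicalNSSolutionOn (Iio 0) ν 0 v q ∧ HasTypeITimeDecay C v ∧
        (∀ k : ℕ, 1 ≤ k → ∀ t : ℝ, t < 0 → ∀ x : E3,
          ‖iteratedFDeriv ℝ k (v t) x‖ ≤ C' k * (-t) ^ (-((k : ℝ) + 1) / 2)) ∧
        IsAdaptedBackwardKernel ν v (Iio 0) 0 0 K ∧ IsGaussianComparable K (Iio 0) 0 0 ∧ 0 < A ∧
        (∀ t : ℝ, t < 0 → adaptedEnstrophy v K t = A * (-t) ^ (-(2 : ℝ))) ∧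
        (∀ t : ℝ, t < 0 →
          HasDerivAt (adaptedEnstrophy v K)
            (∫ x, (2 * (⟪curl (v t) x, fderiv ℝ (v t) x (curl (v t) x)⟫
                - ν * frobeniusNormSq (fderiv ℝ (curl (v t)) x))) * K t x) t)) :=
  Iff.rfl

/-- Stub 3 in `IsFlatInhabitant` form (definitionally the registered signature). -/
theorem not_isFlatInhabitant_of (h₃ : Sig.stub_flatEnstrophyLiouville) (ν C A : ℝ) (C' : ℕ → ℝ)
    (v : ℝ → E3 → E3) (q : ℝ → E3 → ℝ) (K : ℝ → E3 → ℝ) : ¬ IsFlatInhabitant ν C A C' v q K :=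
  fun h => h₃ ν C A C' v q K ((isFlatInhabitant_iff ν C A C' v q K).1 h)

/-! ## Registered stubs

Stubs 1a, 1b, 2a, 2b, 2c are LANDED (wave 1, 2026-08-16): p77940, p77279, p78683, p86161 (+ lemmas p84385),
p82058 — their obligations below are discharged by the tree theorems of
`Summits/…/Theorems/AdaptedFrequencyFrequencyRigidity{UnitTimeDerivBounds,ScaleInvariantBoundsOfUnitTime,
VorticitySqTransport,KernelPairing,VorticitySqBounds}.lean` (namespace `…Theorems.FrequencyRigidity.TwoEndedPinning`).
v6: Stub 3 is SPLIT (below) into S3a, S3b, S3c (small Type-I constant; registered, waved, LANDED in v6.1: p107013, p107082,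
p107150) and S3L (large constant; the open core, held by the lead) — the ONLY `sorry` of the file. -/

/-- Stub 1a — LANDED (p77940). -/
theorem stub_unitTimeDerivBounds : Sig.stub_unitTimeDerivBounds :=
  Theorems.FrequencyRigidity.TwoEndedPinning.stub_unitTimeDerivBounds

/-- Stub 1b — LANDED (p77279). -/
theorem stub_scaleInvariantBounds_of_unitTime : Sig.stub_scaleInvariantBounds_of_unitTime :=
  Theorems.FrequencyRigidity.TwoEndedPinning.stub_scaleInvariantBounds_of_unitTime

/-- Stub 2a — LANDED (p78683). -/
theorem stub_vorticitySqTransport : Sig.stub_vorticitySqTransport :=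
  Theorems.FrequencyRigidity.TwoEndedPinning.stub_vorticitySqTransport

/-- Stub 2b — LANDED (p86161). -/
theorem stub_kernelPairing : Sig.stub_kernelPairing :=
  Theorems.FrequencyRigidity.TwoEndedPinning.stub_kernelPairing

/-- Stub 2c — LANDED (p82058). -/
theorem stub_vorticitySqBounds : Sig.stub_vorticitySqBounds :=
  Theorems.FrequencyRigidity.TwoEndedPinning.stub_vorticitySqBounds

/-! ### Stub 3 RESHAPED (v6): split by the Type-I constant `C/√ν` against `1/(96 C₀)`, `C₀ = oseenSliceConst ℝ³`

Small-constant half = S3a + S3b + S3c (provable, registered, waved); large-constant half = S3L (the open core).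
`flatEnstrophyLiouville_of_split` below recovers the planner's / v2–v5 Stub 3 (`Sig.stub_flatEnstrophyLiouville`)
from the four, sorry-free. -/

/-- **S3a `stub_ancientDriftNormalForm` (provable, M–L) — KNSS's Lemma 3.1 on the WHOLE ancient interval, with the
drift normalised at `t → −∞`.**  For a classical Navier–Stokes flow `(u, p)` (viscosity `1`, zero force) on
`ℝ³ × (−∞,0)` with the global time-Type-I bound `‖u(t,x)‖ ≤ C/√(−t)` there is an `ℝ³`-valued drift `β`, continuous on
`(−∞,0)`, with `‖β(t)‖ ≤ (8C + 32 C₀ C²)/√(−t)` and the INTRINSIC drift identity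
`u(t,y) − e^{(t−s)Δ}u(s)(y) + B¹_s(u,u)(t)(y) = β(t) − β(s)` for all `s < t < 0`, all `y` (the defect of the Oseen
integral equation of `u` is spatially constant).  How: the landed window lemma
`MovingAdjointBernoulli.mildFrame_continuousDrift_window` (file `…MildFrameDriftWindow.lean`) gives, on every window
`(a, b) ⊂ (−∞,0)` on which `u` is bounded, a continuous `β_W` with this identity; the defect
`D(s,t) := u(t,0) − e^{(t−s)Δ}u(s)(0) + B¹_s(u,u)(t)(0)` is therefore spatially constant and a COCYCLE
(`D(r,t) = D(r,s) + D(s,t)`), so `β(t) := D(−1,t)` (`t > −1`), `−D(t,−1)` (`t < −1`), `0` (`t = −1`) is a global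
continuous drift with `D(s,t) = β(t) − β(s)`; the Type-I bound makes `β` Cauchy at `−∞`: for `s' ∈ [4s, s]`,
`‖β(s) − β(s')‖ ≤ ‖u(s)‖ + ‖e^{(s−s')Δ}u(s')‖ + ‖B¹_{s'}(u,u)(s)‖ ≤ (2C + 4C₀C²)/√(−s)` (`norm_heatExtension_le`,
`norm_oseenDuhamel_le_const` with the slab bound `C/√(−s)` and `2√(s − s') ≤ 4√(−s)`… exactly the arithmetic of the
tree's `smallConstantLiouville_step`), and telescoping along `4ᵏt` gives `‖β(t) − β(4ᵏt)‖ ≤ 2(3C/2 + 4C₀C²)/√(−t)`;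
subtract the limit `β_∞` (the identity is invariant under `β ↦ β − β_∞`).  Uses the GLOBAL Type-I bound at `t → −∞`
(Disproof (B): for rigid rotation no normalised drift exists).  [cite: KochNadirashviliSereginSverak2009, §3 Lemma 3.1 and Remark 3.1, §4 p. 8 (arXiv:0709.3599)] -/
def Sig.stub_ancientDriftNormalForm : Prop :=
  ∀ (C : ℝ) (u : ℝ → EuclideanSpace ℝ (Fin 3) → EuclideanSpace ℝ (Fin 3))
    (p : ℝ → EuclideanSpace ℝ (Fin 3) → ℝ),
    Literature.Analysis.FluidPDE.IsClassicalNSSolutionOn (Set.Iio 0) 1 0 u p →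
    Literature.Analysis.FluidPDE.HasTypeITimeDecay C u →
    ∃ β : ℝ → EuclideanSpace ℝ (Fin 3), ContinuousOn β (Set.Iio 0) ∧
      (∀ t : ℝ, t < 0 → ‖β t‖ ≤
        (8 * C + 32 * Literature.Analysis.FluidPDE.oseenSliceConst (EuclideanSpace ℝ (Fin 3)) * C ^ 2) /
          Real.sqrt (-t)) ∧
      ∀ s t : ℝ, s < t → t < 0 → ∀ y : EuclideanSpace ℝ (Fin 3),
        u t y - Literature.Analysis.UnboundedOperators.heatExtension (u s) (t - s) y +
            Literature.Analysis.FluidPDE.oseenDuhamel 1 s u u t y = β t - β s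

/-- **S3b `stub_galileanOseenIdentity` (provable, L; pure bookkeeping over a PROVED tree fact) — the zero-drift
Oseen identity in the co-moving frame.**  Let `(u, p)` be a classical flow (viscosity `1`, zero force) on
`ℝ³ × (−∞,0)` with the Type-I bound, and `β` a drift continuous on `(−∞,0)` with the intrinsic drift identity of S3a.
Then for all `a < s < t < 0` and all `y`, with the frame `B_a(σ) = ∫ₐ^σ β` and the co-moving, drift-subtracted field
`ū(σ, z) = u(σ, z + B_a(σ)) − β(σ)`:  `ū(t, y) = e^{(t−s)Δ}ū(s)(y) − B¹_s(ū, ū)(t)(y)`.  How: on the window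
`(a, t/2) ∋ s, t` (shifted to `(0, T)`), the pair `(U, b) := (u − β, β)` (cut off to `0` outside the window, so that
the global measurability / boundedness fields hold: `ContinuousOn.measurable_piecewise`, `β` bounded on `[a, t/2]`,
`u` bounded by `C/√(−t/2)`) is drift-mild, `IsKNSSDriftMild T N U b`: slices `u(σ) − β(σ)` are weakly divergence free,
and the identity `U(τ) = e^{(τ−σ)Δ}U(σ) − driftDuhamel U b σ τ` is S3a's identity because
`e^{(τ−σ)Δ}(u(σ) − β(σ)) = e^{(τ−σ)Δ}u(σ) − β(σ)` (`heatExtension_sub_of_bound`, `heatExtension_const`) and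
`driftDuhamel U b σ τ = B¹_σ(U + b, U + b)(τ) = B¹_σ(u,u)(τ)` (`driftDuhamel_zero_eq_oseenDuhamel`/`driftDuhamel_congr_ae`
pattern of `…MildFrameDriftWindow.lean` and `KNSSOseenMildDecayOfLemma31`; `oseenDuhamel` only sees the fields on
`(σ, τ) × ℝ³`, `setIntegral_congr_fun`); then the tree's PROVED `IsKNSSDriftMild.GalileanCovariance`
(`KNSSRegularityGalileanProofs`) gives `IsKNSSDriftMild T N (galileanShift U b) 0`, whose `mild` field, shifted back in
time (`oseenDuhamel_comp_sub_right`) and with `driftPath b τ = ∫₀^τ b = ∫ₐ^{a+τ} β`, is the display.  [cite: KochNadirashviliSereginSverak2009, §3 Remark 3.1 and §4 (i) (arXiv:0709.3599); MajdaBertozziCUP2002, §1.2] -/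
def Sig.stub_galileanOseenIdentity : Prop :=
  ∀ (C : ℝ) (u : ℝ → EuclideanSpace ℝ (Fin 3) → EuclideanSpace ℝ (Fin 3))
    (p : ℝ → EuclideanSpace ℝ (Fin 3) → ℝ) (β : ℝ → EuclideanSpace ℝ (Fin 3)),
    Literature.Analysis.FluidPDE.IsClassicalNSSolutionOn (Set.Iio 0) 1 0 u p →
    Literature.Analysis.FluidPDE.HasTypeITimeDecay C u →
    ContinuousOn β (Set.Iio 0) →
    (∀ s t : ℝ, s < t → t < 0 → ∀ y : EuclideanSpace ℝ (Fin 3),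
      u t y - Literature.Analysis.UnboundedOperators.heatExtension (u s) (t - s) y +
          Literature.Analysis.FluidPDE.oseenDuhamel 1 s u u t y = β t - β s) →
    ∀ a s t : ℝ, a < s → s < t → t < 0 → ∀ y : EuclideanSpace ℝ (Fin 3),
      u t (y + ∫ ρ in a..t, β ρ) - β t =
        Literature.Analysis.UnboundedOperators.heatExtension
            (fun z => u s (z + ∫ ρ in a..s, β ρ) - β s) (t - s) y -
          Literature.Analysis.FluidPDE.oseenDuhamel 1 s
            (fun σ z => u σ (z + ∫ ρ in a..σ, β ρ) - β σ)
            (fun σ z => u σ (z + ∫ ρ in a..σ, β ρ) - β σ) t y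

/-- **S3c `stub_smallConstantBootstrap` (provable, M) — the Leray/KNSS gap in the co-moving frame.**  If
`‖u(τ,y) − β(τ)‖ ≤ A/√(−τ)` for all `τ < 0`, `y`, with `0 ≤ A`, `8 C₀ A < 1`, and the co-moving zero-drift Oseen
identity of S3b holds for all `a < s < t < 0`, then `u(t, ·) ≡ β(t)` for every `t < 0`.  How: VERBATIM the tree's
bootstrap `smallConstantLiouville_step/iterate/eq_zero` (`Theorems/ExtremalTypeIConstantSmallConstantLiouville.lean`)
with `h.mild_eq` replaced by the identity of S3b at `a = 4t − 1`, `s = 4t`: sup norms are blind to the frame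
translation `z ↦ z + B_a(σ)`, so with `M(τ) := sup_y ‖u(τ,y) − β(τ)‖` one gets
`M(t) ≤ A/(2√(−t)) + 4C₀A²/√(−t)` (`norm_heatExtension_le`, `norm_oseenDuhamel_le_const` — no measurability needed),
the map `A ↦ A(1/2 + 4C₀A)` contracts, and `M ≡ 0`.  [cite: KochNadirashviliSereginSverak2009, §4 p. 8 and §6 (arXiv:0709.3599)] -/
def Sig.stub_smallConstantBootstrap : Prop :=
  ∀ (A : ℝ) (u : ℝ → EuclideanSpace ℝ (Fin 3) → EuclideanSpace ℝ (Fin 3)) (β : ℝ → EuclideanSpace ℝ (Fin 3)),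
    0 ≤ A → 8 * Literature.Analysis.FluidPDE.oseenSliceConst (EuclideanSpace ℝ (Fin 3)) * A < 1 →
    (∀ τ : ℝ, τ < 0 → ∀ y : EuclideanSpace ℝ (Fin 3), ‖u τ y - β τ‖ ≤ A / Real.sqrt (-τ)) →
    (∀ a s t : ℝ, a < s → s < t → t < 0 → ∀ y : EuclideanSpace ℝ (Fin 3),
      u t (y + ∫ ρ in a..t, β ρ) - β t =
        Literature.Analysis.UnboundedOperators.heatExtension
            (fun z => u s (z + ∫ ρ in a..s, β ρ) - β s) (t - s) y -
          Literature.Analysis.FluidPDE.oseenDuhamel 1 s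
            (fun σ z => u σ (z + ∫ ρ in a..σ, β ρ) - β σ)
            (fun σ z => u σ (z + ∫ ρ in a..σ, β ρ) - β σ) t y) →
    ∀ t : ℝ, t < 0 → ∀ y : EuclideanSpace ℝ (Fin 3), u t y = β t

/-- **S3L `stub_flatEnstrophyLiouville_largeConstant` (the OPEN CORE, held by the lead) — no flat inhabitant with a
LARGE Type-I constant, `C/√ν ≥ 1/(96 C₀)`.**  Everything said about Stub 3 applies verbatim: it CONTAINS the bounded-class
RSS-Liouville theorem for every `α ≠ 0` UNCONDITIONALLY (`wall_rssLiouvilleBounded` below: the small-constant regime holds no RSS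
flow with `curl U ≢ 0`, by S3a–S3c), and is implied by (L) (`stub_flatEnstrophyLiouville_largeConstant_of_liouvilleConjectureNS`,
`Theorems/…OfLiouville.lean`, p107437): the small-constant cut removes exactly the perturbative regime and nothing else.
[cite: BradshawTsai2017CPDE, §5 OP 5.2; PineauVicol2026, Conj. 1.1; KochNadirashviliSereginSverak2009, §1 (L)] -/
def Sig.stub_flatEnstrophyLiouville_largeConstant : Prop :=
  ∀ (ν C A : ℝ) (C' : ℕ → ℝ) (v : ℝ → EuclideanSpace ℝ (Fin 3) → EuclideanSpace ℝ (Fin 3))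
    (q : ℝ → EuclideanSpace ℝ (Fin 3) → ℝ) (K : ℝ → EuclideanSpace ℝ (Fin 3) → ℝ),
    1 / (96 * Literature.Analysis.FluidPDE.oseenSliceConst (EuclideanSpace ℝ (Fin 3))) ≤ C / Real.sqrt ν →
    ¬ (0 < ν ∧ Literature.Analysis.FluidPDE.IsClassicalNSSolutionOn (Set.Iio 0) ν 0 v q ∧
        Literature.Analysis.FluidPDE.HasTypeITimeDecay C v ∧
        (∀ k : ℕ, 1 ≤ k → ∀ t : ℝ, t < 0 → ∀ x : EuclideanSpace ℝ (Fin 3),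
          ‖iteratedFDeriv ℝ k (v t) x‖ ≤ C' k * (-t) ^ (-((k : ℝ) + 1) / 2)) ∧
        Literature.Analysis.FluidPDE.IsAdaptedBackwardKernel ν v (Set.Iio 0) 0 0 K ∧
        Literature.Analysis.FluidPDE.IsGaussianComparable K (Set.Iio 0) 0 0 ∧ 0 < A ∧
        (∀ t : ℝ, t < 0 →
          Literature.Analysis.FluidPDE.adaptedEnstrophy v K t = A * (-t) ^ (-(2 : ℝ))) ∧
        (∀ t : ℝ, t < 0 →
          HasDerivAt (Literature.Analysis.FluidPDE.adaptedEnstrophy v K)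
            (∫ x, (2 * (inner ℝ (Literature.Analysis.FluidPDE.curl (v t) x)
                          (fderiv ℝ (v t) x (Literature.Analysis.FluidPDE.curl (v t) x))
                        - ν * Literature.Analysis.FluidPDE.frobeniusNormSq
                          (fderiv ℝ (Literature.Analysis.FluidPDE.curl (v t)) x))) * K t x) t))

/-- S3a — LANDED (p107013, wave 2): the ancient drift normal form. -/
theorem stub_ancientDriftNormalForm : Sig.stub_ancientDriftNormalForm :=
  Theorems.FrequencyRigidity.TwoEndedPinning.stub_ancientDriftNormalForm

/-- S3b — LANDED (p107082, wave 2): the co-moving zero-drift Oseen identity. -/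
theorem stub_galileanOseenIdentity : Sig.stub_galileanOseenIdentity :=
  Theorems.FrequencyRigidity.TwoEndedPinning.stub_galileanOseenIdentity

/-- S3c — LANDED (p107150, this seat): the small-constant bootstrap. -/
theorem stub_smallConstantBootstrap : Sig.stub_smallConstantBootstrap :=
  Theorems.FrequencyRigidity.TwoEndedPinning.stub_smallConstantBootstrap

/-- S3L — OPEN (registered; the open core, held by the lead): no flat inhabitant with a LARGE Type-I constant,
registered in expanded form. -/
theorem stub_flatEnstrophyLiouville_largeConstant :
    ∀ (ν C A : ℝ) (C' : ℕ → ℝ) (v : ℝ → EuclideanSpace ℝ (Fin 3) → EuclideanSpace ℝ (Fin 3))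
      (q : ℝ → EuclideanSpace ℝ (Fin 3) → ℝ) (K : ℝ → EuclideanSpace ℝ (Fin 3) → ℝ),
      1 / (96 * Literature.Analysis.FluidPDE.oseenSliceConst (EuclideanSpace ℝ (Fin 3))) ≤ C / Real.sqrt ν →
      ¬ (0 < ν ∧ Literature.Analysis.FluidPDE.IsClassicalNSSolutionOn (Set.Iio 0) ν 0 v q ∧
          Literature.Analysis.FluidPDE.HasTypeITimeDecay C v ∧
          (∀ k : ℕ, 1 ≤ k → ∀ t : ℝ, t < 0 → ∀ x : EuclideanSpace ℝ (Fin 3),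
            ‖iteratedFDeriv ℝ k (v t) x‖ ≤ C' k * (-t) ^ (-((k : ℝ) + 1) / 2)) ∧
          Literature.Analysis.FluidPDE.IsAdaptedBackwardKernel ν v (Set.Iio 0) 0 0 K ∧
          Literature.Analysis.FluidPDE.IsGaussianComparable K (Set.Iio 0) 0 0 ∧ 0 < A ∧
          (∀ t : ℝ, t < 0 →
            Literature.Analysis.FluidPDE.adaptedEnstrophy v K t = A * (-t) ^ (-(2 : ℝ))) ∧
          (∀ t : ℝ, t < 0 →
            HasDerivAt (Literature.Analysis.FluidPDE.adaptedEnstrophy v K)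
              (∫ x, (2 * (inner ℝ (Literature.Analysis.FluidPDE.curl (v t) x)
                            (fderiv ℝ (v t) x (Literature.Analysis.FluidPDE.curl (v t) x))
                          - ν * Literature.Analysis.FluidPDE.frobeniusNormSq
                            (fderiv ℝ (Literature.Analysis.FluidPDE.curl (v t)) x))) * K t x) t)) := by
  sorry

/-! ### Proved glue (v6): the small-constant half, and Stub 3 from the split -/

/-- The time line `r ↦ 0 + 1·r` pulls `(−∞, 0)` back to itself. [folklore] -/
private theorem preimage_zero_add_one_mul_Iio' :
    ((fun r => (0 : ℝ) + 1 * r) ⁻¹' Iio 0) = Iio 0 := by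
  ext r; simp

/-- **Viscosity normalisation on `(−∞,0)`** (`IsClassicalNSSolutionOn.stRescale`, `α = ν^{−1/2}`, `γ = √ν`, `β = 1`):
`w(s,y) = ν^{−1/2} v(s, √ν y)` is a classical flow with viscosity `1`. [cite: Tao2011, footnote 3] -/
theorem classical_viscosityNormalise' {ν : ℝ} (hν : 0 < ν) {v : ℝ → E3 → E3} {q : ℝ → E3 → ℝ}
    (h : IsClassicalNSSolutionOn (Iio 0) ν 0 v q) :
    IsClassicalNSSolutionOn (Iio 0) 1 0 ((Real.sqrt ν)⁻¹ • stPull 1 (Real.sqrt ν) 0 0 v)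
      (((Real.sqrt ν)⁻¹ ^ 2) • stPull 1 (Real.sqrt ν) 0 0 q) := by
  set m : ℝ := Real.sqrt ν with hm
  have hm0 : 0 < m := Real.sqrt_pos.2 hν
  have key := h.stRescale (α := m⁻¹) (β := 1) (γ := m) (inv_pos.2 hm0) hm0
    (by rw [inv_mul_cancel₀ hm0.ne']) 0 0
  have hmm : m * m = ν := by rw [hm]; exact Real.mul_self_sqrt hν.le
  have hvis : m⁻¹ * ν / m = 1 := by
    rw [← hmm]; field_simp
  have hforce : ((m⁻¹ ^ 2 * m) • stPull 1 m 0 0 (0 : ℝ → E3 → E3)) = 0 := by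
    funext s y
    simp [stPull]
  rw [preimage_zero_add_one_mul_Iio', hvis, hforce] at key
  exact key

/-- The arithmetic of the threshold: `x < 1/96` forces `8 (9x + 32x²) < 1`. [folklore] -/
private theorem threshold_arith {x : ℝ} (hx0 : 0 ≤ x) (hx : x < 1 / 96) :
    8 * (9 * x + 32 * x ^ 2) < 1 := by
  nlinarith

/-- **The small-constant half of Stub 3 from S3a + S3b + S3c** (proved glue).  A flat inhabitant with
`C/√ν < 1/(96 C₀)` is impossible: normalise the viscosity (`w(s,y) = ν^{−1/2}v(s, √ν y)`, Type-I constant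
`C₁ = C/√ν`), take the normalised drift `β` of S3a (`‖β‖ ≤ (8C₁ + 32C₀C₁²)/√(−t)`), so that
`‖w − β‖ ≤ A/√(−t)` with `A = 9C₁ + 32C₀C₁²` and `8C₀A < 1` (`threshold_arith`); S3b feeds S3c, whence
`w(t,·) ≡ β(t)`, the slices of `v` are constant, `curl v(−1) ≡ 0` and `H(−1) = 0`, contradicting `H(−1) = A > 0`. -/
theorem flatEnstrophyLiouville_smallConstant (h3a : Sig.stub_ancientDriftNormalForm)
    (h3b : Sig.stub_galileanOseenIdentity) (h3c : Sig.stub_smallConstantBootstrap)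
    (ν C A : ℝ) (C' : ℕ → ℝ) (v : ℝ → E3 → E3) (q : ℝ → E3 → ℝ) (K : ℝ → E3 → ℝ)
    (hsmall : C / Real.sqrt ν < 1 / (96 * oseenSliceConst E3)) :
    ¬ IsFlatInhabitant ν C A C' v q K := by
  rintro ⟨hν, hNS, hTI, -, -, -, hA, hflat, -⟩
  set m : ℝ := Real.sqrt ν with hm
  have hm0 : 0 < m := Real.sqrt_pos.2 hν
  have hC₀ : 0 < oseenSliceConst E3 := oseenSliceConst_pos
  have hC0 : 0 ≤ C := by
    have h1 := hTI (-1) (by norm_num) 0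
    have h2 : (0 : ℝ) ≤ C / Real.sqrt (-(-1:ℝ)) := (norm_nonneg _).trans h1
    simpa using h2
  -- ## the normalised flow `w`, Type-I with constant `C₁ = C/m`
  set C₁ : ℝ := C / m with hC₁
  have hC₁0 : 0 ≤ C₁ := div_nonneg hC0 hm0.le
  set w : ℝ → E3 → E3 := m⁻¹ • stPull 1 m 0 0 v with hw_def
  have hw : IsClassicalNSSolutionOn (Iio 0) 1 0 w ((m⁻¹ ^ 2) • stPull 1 m 0 0 q) :=
    classical_viscosityNormalise' hν hNS
  have hw_apply : ∀ s y, w s y = m⁻¹ • v s (m • y) := by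
    intro s y
    simp [hw_def, stPull]
  have hwTI : HasTypeITimeDecay C₁ w := by
    intro s hs y
    rw [hw_apply, norm_smul, Real.norm_of_nonneg (inv_nonneg.2 hm0.le), hC₁, div_div,
      mul_comm m, ← div_div, div_eq_inv_mul]
    exact mul_le_mul_of_nonneg_left (hTI s hs (m • y)) (inv_nonneg.2 hm0.le)
  -- ## the drift and the co-moving identity
  obtain ⟨β, hβc, hβb, hid⟩ := h3a C₁ w _ hw hwTI
  have hgal := h3b C₁ w _ β hw hwTI hβc hid
  -- ## the constant `A₀ = 9C₁ + 32C₀C₁²` and the threshold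
  set A₀ : ℝ := 9 * C₁ + 32 * oseenSliceConst E3 * C₁ ^ 2 with hA₀
  have hA₀0 : 0 ≤ A₀ := by rw [hA₀]; positivity
  have hx : oseenSliceConst E3 * C₁ < 1 / 96 := by
    have h1 : C₁ < 1 / (96 * oseenSliceConst E3) := hsmall
    rw [lt_div_iff₀ (by positivity)] at h1
    rw [lt_div_iff₀ (by norm_num : (0:ℝ) < 96)]
    linarith
  have hthr : 8 * oseenSliceConst E3 * A₀ < 1 := by
    have key := threshold_arith (mul_nonneg hC₀.le hC₁0) hx
    have e : 8 * oseenSliceConst E3 * A₀ =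
        8 * (9 * (oseenSliceConst E3 * C₁) + 32 * (oseenSliceConst E3 * C₁) ^ 2) := by
      rw [hA₀]; ring
    rw [e]; exact key
  have hbound : ∀ τ : ℝ, τ < 0 → ∀ y : E3, ‖w τ y - β τ‖ ≤ A₀ / Real.sqrt (-τ) := by
    intro τ hτ y
    have h1 := hwTI τ hτ y
    have h2 := hβb τ hτ
    have hsq : 0 < Real.sqrt (-τ) := Real.sqrt_pos.2 (by linarith)
    calc ‖w τ y - β τ‖ ≤ ‖w τ y‖ + ‖β τ‖ := norm_sub_le _ _
      _ ≤ C₁ / Real.sqrt (-τ) + (8 * C₁ + 32 * oseenSliceConst E3 * C₁ ^ 2) / Real.sqrt (-τ) :=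
          add_le_add h1 h2
      _ = A₀ / Real.sqrt (-τ) := by rw [hA₀]; field_simp; ring
  -- ## the bootstrap: `w(t, ·) ≡ β(t)`
  have hconst := h3c A₀ w β hA₀0 hthr hbound hgal
  -- ## back to `v`: constant slices, `curl v(−1) = 0`, `H(−1) = 0 ≠ A`
  have hv : ∀ x, v (-1) x = m • β (-1) := by
    intro x
    have h1 := hconst (-1) (by norm_num) (m⁻¹ • x)
    rw [hw_apply, smul_smul, mul_inv_cancel₀ hm0.ne', one_smul] at h1
    rw [← h1, smul_smul, mul_inv_cancel₀ hm0.ne', one_smul]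
  have hc : ∀ x, curl (v (-1)) x = 0 := by
    intro x
    have e : v (-1) = fun _ => m • β (-1) := funext hv
    rw [e]; simp [curl]
  have h1 := hflat (-1) (by norm_num)
  have hzero : adaptedEnstrophy v K (-1) = 0 := by
    simp [adaptedEnstrophy, hc]
  rw [hzero] at h1
  norm_num at h1
  linarith

/-- **Stub 3 from the split** (proved glue): the planner's / v2–v5 `Sig.stub_flatEnstrophyLiouville` from the three
small-constant stubs and the large-constant stub, by `lt_or_le (C/√ν) (1/(96 C₀))`. -/
theorem flatEnstrophyLiouville_of_split (h3a : Sig.stub_ancientDriftNormalForm)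
    (h3b : Sig.stub_galileanOseenIdentity) (h3c : Sig.stub_smallConstantBootstrap)
    (h3L : Sig.stub_flatEnstrophyLiouville_largeConstant) : Sig.stub_flatEnstrophyLiouville := by
  intro ν C A C' v q K h
  rcases lt_or_ge (C / Real.sqrt ν) (1 / (96 * oseenSliceConst E3)) with hs | hl
  · exact flatEnstrophyLiouville_smallConstant h3a h3b h3c ν C A C' v q K hs
      ((isFlatInhabitant_iff ν C A C' v q K).2 h)
  · exact h3L ν C A C' v q K hl h

/-- Stub 3 (the v2–v5 registered signature), now DERIVED from the v6 split. -/
theorem stub_flatEnstrophyLiouville : Sig.stub_flatEnstrophyLiouville :=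
  flatEnstrophyLiouville_of_split stub_ancientDriftNormalForm stub_galileanOseenIdentity
    stub_smallConstantBootstrap stub_flatEnstrophyLiouville_largeConstant

/-! ## Landed leaves of Stub 3 (registered sub-goals, ACCEPTED) — necessary conditions on a flat inhabitant

They do not enter `FrequencyRigidity_of` (Stub 3 is consumed whole); they are re-exported here so that the skeleton
records what any future attack on Stub 3 may assume. -/

/-- Leaf (lead-0, p87055): no EXACTLY backward-self-similar flat inhabitant (Tsai 1998 Thm 1, `q = ∞`). -/
alias leaf_selfSimilar := Theorems.FrequencyRigidity.TwoEndedPinning.stub_flatEnstrophyLiouville_selfSimilar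

/-- Leaf (lead-0, p88400): no flat inhabitant with an instantaneously steady similarity slice. -/
alias leaf_noSteadySlice := Theorems.FrequencyRigidity.TwoEndedPinning.stub_flatEnstrophyLiouville_noSteadySlice

/-- Leaf (lead c1, p97154): the critical-strain floor — `⟪ω, Dv ω⟫ ≤ M‖ω‖²` on `ℝ³` at some `t < 0` forces
`M ≥ 1/(−t)` (so `sup‖Dv(t)‖ ≥ 1/(−t)`, `C'₁ ≥ 1`, no stretching-free/planar inhabitant). -/
alias leaf_strainFloor := Theorems.FrequencyRigidity.TwoEndedPinning.stub_flatEnstrophyLiouville_strainFloor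

/-- Leaf (lead c1, p98197): the floor is STRICT — `M > 1/(−t)` (vorticity never spatially constant,
`∫|∇ω|²K > 0`, palinstrophy balance `ν∫|∇ω|²K = ∫⟪ω,Dvω⟫K − A(−t)^{−3}`, `C'₁ > 1`). -/
alias leaf_strictStrainFloor :=
  Theorems.FrequencyRigidity.TwoEndedPinning.stub_flatEnstrophyLiouville_strictStrainFloor

/-! ## Proved glue: the planner's two stubs from the reshaped ones -/

/-- Planner's Stub 1 from Stubs 1a + 1b (definitional unfolding of `ScaleInvariantBounds`). -/
theorem scaleInvariantBounds_of (h1a : Sig.stub_unitTimeDerivBounds)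
    (h1b : Sig.stub_scaleInvariantBounds_of_unitTime) : Sig.stub_scaleInvariantBounds := by
  intro ν C hν
  obtain ⟨C', hC'⟩ := h1b h1a ν C hν
  exact ⟨C', fun v q hNS hTI k hk t ht x => hC' v q hNS hTI k hk t ht x⟩

/-- Planner's Stub 2 from Stubs 2a + 2b + 2c: apply the kernel pairing to `φ = ‖curl v‖²` (its
hypotheses are Stub 2c) and rewrite the integrand pointwise by the transport identity (Stub 2a). -/
theorem enstrophyFirstVariation_of (h2a : Sig.stub_vorticitySqTransport) (h2b : Sig.stub_kernelPairing)
    (h2c : Sig.stub_vorticitySqBounds) : Sig.stub_enstrophyFirstVariation := by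
  intro ν C C' v q K _hν hNS hTI hB hK hG t ht
  obtain ⟨hφ, hbd⟩ := h2c ν C C' v q hNS hTI hB
  have hd := h2b ν C v K (fun t x => ‖curl (v t) x‖ ^ 2) hNS.smooth_velocity hNS.divFree hTI hK hG
    hφ hbd t ht
  have hfun : adaptedEnstrophy v K = fun s => ∫ x, ‖curl (v s) x‖ ^ 2 * K s x := rfl
  have hint : (∫ x, (deriv (fun s => ‖curl (v s) x‖ ^ 2) t
        + fderiv ℝ (fun y => ‖curl (v t) y‖ ^ 2) x (v t x)
        - ν * Laplacian.laplacian (fun y => ‖curl (v t) y‖ ^ 2) x) * K t x) =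
      ∫ x, firstVariationDensity ν v t x * K t x := by
    refine integral_congr_ae (Eventually.of_forall fun x => ?_)
    simp only [firstVariationDensity]
    rw [h2a ν v q hNS t ht x]
  rw [hfun, ← hint]
  exact hd

/-! ## Proved glue: the two-ended enstrophy bound from the scale-invariant bounds -/

/-- `‖curl v(t,x)‖ ≤ ‖curlCLM‖ · C'_1 · (−t)^{−1}` under the scale-invariant bounds (`k = 1`). -/
theorem norm_curl_le_of_bounds {C' : ℕ → ℝ} {v : ℝ → E3 → E3} (hB : ScaleInvariantBounds C' v)
    {t : ℝ} (ht : t < 0) (x : E3) :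
    ‖curl (v t) x‖ ≤ ‖curlCLM‖ * C' 1 * (-t) ^ (-(1 : ℝ)) := by
  have h1 := hB 1 le_rfl t ht x
  rw [norm_iteratedFDeriv_one] at h1
  have h2 : (-(((1 : ℕ) : ℝ) + 1) / 2 : ℝ) = -(1 : ℝ) := by norm_num
  rw [h2] at h1
  calc ‖curl (v t) x‖ ≤ ‖curlCLM‖ * ‖fderiv ℝ (v t) x‖ := norm_curl_le _ _
    _ ≤ ‖curlCLM‖ * (C' 1 * (-t) ^ (-(1 : ℝ))) :=
        mul_le_mul_of_nonneg_left h1 (norm_nonneg curlCLM)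
    _ = ‖curlCLM‖ * C' 1 * (-t) ^ (-(1 : ℝ)) := by ring

/-- **The two-ended Type-I ENSTROPHY bound** `H(t) ≤ (‖curlCLM‖ C'_1)² (−t)^{−2}` for every `t < 0`:
pointwise vorticity bound, positivity and UNIT MASS of the kernel (Gaussian comparability is not needed
for this step, triage G1). -/
theorem adaptedEnstrophy_le_of_bounds {ν : ℝ} {C' : ℕ → ℝ} {v : ℝ → E3 → E3} {K : ℝ → E3 → ℝ}
    (hB : ScaleInvariantBounds C' v) (hK : IsAdaptedBackwardKernel ν v (Iio 0) 0 0 K)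
    {t : ℝ} (ht : t < 0) :
    (∫ x, ‖curl (v t) x‖ ^ 2 * K t x) ≤ (‖curlCLM‖ * C' 1) ^ 2 * (-t) ^ (-(2 : ℝ)) := by
  have hneg : 0 < -t := by linarith
  have ht' : t ∈ Iio (0 : ℝ) := ht
  have hsq : ∀ x, ‖curl (v t) x‖ ^ 2 ≤ (‖curlCLM‖ * C' 1) ^ 2 * (-t) ^ (-(2 : ℝ)) := fun x => by
    have hω := norm_curl_le_of_bounds hB ht x
    have h1 : ‖curl (v t) x‖ ^ 2 ≤ (‖curlCLM‖ * C' 1 * (-t) ^ (-(1 : ℝ))) ^ 2 :=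
      pow_le_pow_left₀ (norm_nonneg _) hω 2
    have h2 : ((-t) ^ (-(1 : ℝ))) ^ 2 = (-t) ^ (-(2 : ℝ)) := by
      rw [← Real.rpow_natCast, ← Real.rpow_mul hneg.le]
      norm_num
    calc ‖curl (v t) x‖ ^ 2 ≤ (‖curlCLM‖ * C' 1 * (-t) ^ (-(1 : ℝ))) ^ 2 := h1
      _ = (‖curlCLM‖ * C' 1) ^ 2 * ((-t) ^ (-(1 : ℝ))) ^ 2 := by ring
      _ = (‖curlCLM‖ * C' 1) ^ 2 * (-t) ^ (-(2 : ℝ)) := by rw [h2]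
  have hint : Integrable (fun x => (‖curlCLM‖ * C' 1) ^ 2 * (-t) ^ (-(2 : ℝ)) * K t x) :=
    (hK.integrable ht').const_mul _
  calc (∫ x, ‖curl (v t) x‖ ^ 2 * K t x)
      ≤ ∫ x, (‖curlCLM‖ * C' 1) ^ 2 * (-t) ^ (-(2 : ℝ)) * K t x :=
        integral_mono_of_nonneg
          (Eventually.of_forall fun x => mul_nonneg (sq_nonneg _) (hK.pos t ht' x).le) hint
          (Eventually.of_forall fun x => mul_le_mul_of_nonneg_right (hsq x) (hK.pos t ht' x).le)
    _ = (‖curlCLM‖ * C' 1) ^ 2 * (-t) ^ (-(2 : ℝ)) := by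
        rw [integral_const_mul, hK.integral_eq_one t ht', mul_one]

/-! ## The composition: pinning (imported, checked) + the three stubs ⇒ the crux BY NAME -/

/-- **The line.**  The six registered stubs imply `FrequencyRigidity`: unbundle a witness; Stubs 1a+1b give
the scale-invariant bounds, Stubs 2a+2b+2c the differentiability of `H`, `adaptedEnstrophy_le_of_bounds` the
two-ended enstrophy bound; the disprover's CHECKED `FreqClause.exponent_eq_two` pins `Λ₀ = 2` and
`FreqClause.power_law` turns the witness into a flat inhabitant with `A = H(−1) > 0` (positivity clause),
which Stub 3 forbids. -/
theorem FrequencyRigidity_of (h1a : Sig.stub_unitTimeDerivBounds)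
    (h1b : Sig.stub_scaleInvariantBounds_of_unitTime) (h2a : Sig.stub_vorticitySqTransport)
    (h2b : Sig.stub_kernelPairing) (h2c : Sig.stub_vorticitySqBounds)
    (h₃ : Sig.stub_flatEnstrophyLiouville) :
    Theses.AdaptedFrequency.FrequencyRigidity := by
  have h₁ : Sig.stub_scaleInvariantBounds := scaleInvariantBounds_of h1a h1b
  have h₂ : Sig.stub_enstrophyFirstVariation := enstrophyFirstVariation_of h2a h2b h2c
  rw [Theorems.FrequencyRigidity.Negative.frequencyRigidity_iff]
  rintro ⟨ν, C, Λ₀, v, q, K, hν, hNS, hTI, hKc, hCmp, hF⟩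
  have hTI' : HasTypeITimeDecay C v := fun t ht x => hTI t ht x
  obtain ⟨hK1, hK2, hK3, hK4, hK5⟩ := hKc
  have hK : IsAdaptedBackwardKernel ν v (Iio 0) 0 0 K := ⟨hK1, hK2, hK3, hK4, hK5⟩
  obtain ⟨c₁, c₂, C₁, C₂, hc₁, hc₂, hC₁, hC₂, hcmp⟩ := hCmp
  have hG : IsGaussianComparable K (Iio 0) 0 0 :=
    isGaussianComparable_iff_fin_three.2 ⟨c₁, c₂, C₁, C₂, hc₁, hc₂, hC₁, hC₂, hcmp⟩
  obtain ⟨C', hC'⟩ := h₁ ν C hν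
  have hB : ScaleInvariantBounds C' v := hC' v q hNS hTI'
  have hFV := h₂ ν C C' v q K hν hNS hTI' hB hK hG
  have hd : ∀ t < 0, DifferentiableAt ℝ (fun t => ∫ x, ‖curl (v t) x‖ ^ 2 * K t x) t :=
    fun t ht => (hFV t ht).differentiableAt
  have hM : ∀ t < 0, (∫ x, ‖curl (v t) x‖ ^ 2 * K t x) ≤
      (‖curlCLM‖ * C' 1) ^ 2 * (-t) ^ (-(2 : ℝ)) :=
    fun t ht => adaptedEnstrophy_le_of_bounds hB hK ht
  have hΛ : Λ₀ = 2 := hF.exponent_eq_two hd hM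
  refine not_isFlatInhabitant_of h₃ ν C (∫ x, ‖curl (v (-1)) x‖ ^ 2 * K (-1) x) C' v q K
    ⟨hν, hNS, hTI', hB, hK, hG, ?_, ?_, hFV⟩
  · exact (hF _ _ rfl rfl).1 (-1) (by norm_num)
  · intro t ht
    rw [adaptedEnstrophy_apply, hF.power_law hd ht, hΛ]

/-- The skeleton instantiated: the crux modulo the registered stubs (v6.1: 1a–2c, S3a–S3c landed; ONLY S3L open). -/
theorem FrequencyRigidity_skeleton : Theses.AdaptedFrequency.FrequencyRigidity :=
  FrequencyRigidity_of stub_unitTimeDerivBounds stub_scaleInvariantBounds_of_unitTime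
    stub_vorticitySqTransport stub_kernelPairing stub_vorticitySqBounds stub_flatEnstrophyLiouville

/-! ## Closures (v6.2): the crux between two named open Liouville problems, both arrows CHECKED

* UPPER: `LiouvilleConjectureNS → FrequencyRigidity` is the landed tree theorem
  `Theorems.FrequencyRigidity.TwoEndedPinning.frequencyRigidity_of_liouvilleConjectureNS` (p107437; the frequency clause is not
  used), and (L) also gives the open stub S3L (`…stub_flatEnstrophyLiouville_largeConstant_of_liouvilleConjectureNS`) — NOT
  re-exported here, so that the only theorem of this workfile concluding the crux stays the stub composition
  `FrequencyRigidity_skeleton` (closed = false while S3L is open);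
* LOWER: `FrequencyRigidity → ∀ α, RSSLiouvilleBounded α` UNCONDITIONALLY (landed wall engine);
* and the crux is EQUIVALENT to its one open stub: `crux_iff_S3L` (tree theorem
  `frequencyRigidity_iff_flatEnstrophyLiouville_largeConstant`). -/

/-- The FLAT REDUCTION at v6 (re-export of the landed tree theorem): the crux is EQUIVALENT to its only open stub S3L. -/
theorem crux_iff_S3L :
    Theses.AdaptedFrequency.FrequencyRigidity ↔ Sig.stub_flatEnstrophyLiouville_largeConstant :=
  Theorems.FrequencyRigidity.TwoEndedPinning.frequencyRigidity_iff_flatEnstrophyLiouville_largeConstant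

/-- THE WALL, UNCONDITIONAL (re-export): the crux proves the bounded-profile RSS Liouville theorem for every angular speed. -/
theorem wall_rssLiouvilleBounded (h : Theses.AdaptedFrequency.FrequencyRigidity) (α : ℝ) :
    Theorems.FrequencyRigidity.Negative.RSSLiouvilleBounded α :=
  Theorems.FrequencyRigidity.MovingAdjointBernoulli.rssWall_unconditional h α

/-- Hence the ONE open stub S3L already carries the whole wall: S3L ⇒ bounded-class RSS-Liouville for every `α`. -/
theorem wall_of_S3L (h3L : Sig.stub_flatEnstrophyLiouville_largeConstant) (α : ℝ) :
    Theorems.FrequencyRigidity.Negative.RSSLiouvilleBounded α :=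
  wall_rssLiouvilleBounded (crux_iff_S3L.2 h3L) α

/-- The SHARP upper arrow read on the ONE open stub (v7, re-export of the landed tree theorem p121984): the Type-I
ancient Liouville statement (L′) = item stmt-NavierStokesRegularity-4050 implies S3L (hence the crux, by `crux_iff_S3L`;
the crux-level bridge `Theorems.FrequencyRigidity.TwoEndedPinning.frequencyRigidity_of_typeIAncientLiouville` is NOT
re-exported here, so that the only theorem of this workfile concluding the crux by name stays the stub composition
`FrequencyRigidity_skeleton`, closed = false while S3L is open). -/
theorem S3L_of_typeIAncientLiouville (hL : Theses.ExtremalTypeIConstant.TypeIAncientLiouville) :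
    Sig.stub_flatEnstrophyLiouville_largeConstant :=
  Theorems.FrequencyRigidity.TwoEndedPinning.stub_flatEnstrophyLiouville_largeConstant_of_typeIAncientLiouville hL

end Summit.NavierStokesRegularity.NavierStokesRegularity.Cruxes.FrequencyRigidity.TwoEndedPinning

end
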